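import Summits.HodgeConjecture.HodgeConjecture.Theses.LinearSystemTorelli
import Literature.AlgebraicGeometry.HodgeTheory.MiddleDimensionReductionOfHodgeModels
import Literature.AlgebraicGeometry.HodgeTheory.MiddleDimensionReductionHolds
import Literature.AlgebraicGeometry.HodgeTheory.HypersurfaceSectionLefschetz
import Literature.AlgebraicGeometry.HodgeTheory.SupportedClassesHodgeConiveau
import Literature.AlgebraicGeometry.HodgeTheory.AlgebraicClassesCup
import Literature.AlgebraicGeometry.HodgeTheory.AmbientClassesMoving
import Literature.AlgebraicGeometry.HodgeTheory.HypersurfaceLefschetzUpper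
import Literature.AlgebraicGeometry.HodgeTheory.GysinBaseChange
import Literature.AlgebraicGeometry.HodgeTheory.ComplexGysinRational
import Literature.AlgebraicGeometry.HodgeTheory.RationalClassesRingChange
import Literature.AlgebraicGeometry.HodgeTheory.GysinHodgeClassLiftProofs
import Literature.AlgebraicGeometry.Motives.UniversalHyperplaneSection
import Literature.AlgebraicGeometry.Motives.ProjectiveSpaceFieldPointsBijective
import Literature.AlgebraicGeometry.Motives.ComplexPointsOpenDense
import Literature.AlgebraicGeometry.Motives.VarietiesGeometricallyIntegralProofs
import Literature.Topology.FourManifolds.ComplexProjectiveSpaceHomologyProofs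
import Summits.HodgeConjecture.HodgeConjecture.Theorems.PadicSemiregularLiftHodgeBeyondAnchorsProductsNotAnchors

/-!
# Route LinearSystemTorelli — `PencilReduction` (item stmt-HodgeConjecture-1083): topological inputs

Helper file of the conditional assembly `LinearSystemTorelliPencilReduction` (incidence-divisor proof of
Thomas 2005 Prop. 2): the Segre-type closed immersion `X × (ℙᴺ)^* ↪ ℙ^{N²+2N}` whose hyperplane section
by the incidence form is the incidence divisor; `N ≥ 1` for an embedded positive-dimensional `X`; slices
`X × {t}` kill classes of positive degree from the parameter space; `H¹(ℙᴺ(ℂ); ℂ) = 0`; and "ambient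
class ∪ algebraic class is algebraic" (the easy half of the moving lemma, from the tree's
`map_projectiveSpace_mem_iSup_ker_restrictCompl`). Everything is proved.
-/

noncomputable section

open scoped Manifold ContDiff
open CategoryTheory CategoryTheory.Limits AlgebraicGeometry MonoidalCategory CartesianMonoidalCategory
open Literature.AlgebraicTopology.SingularHomology
open Literature.AlgebraicGeometry Literature.AlgebraicGeometry.Motives Literature.AlgebraicGeometry.HodgeTheory

set_option linter.dupNamespace false

namespace Summit.HodgeConjecture.HodgeConjecture.Theorems

/-! ### The incidence divisor of `X ⊂ ℙᴺ` as a hypersurface section of `X × (ℙᴺ)^*` -/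

/-- `X × (ℙᴺ)^* → ℙᴺ × ℙᴺ → ℙ^{N²+2N}` (`ι` then Segre) is a closed immersion when `ι` is.
[cite: Hartshorne1977, II Ex. 5.11 and Ex. 3.11(a)] -/
theorem isClosedImmersion_toSegre_left (N : ℕ) {X : SchemeOver ℂ} (ι : X ⟶ projectiveSpace N ℂ)
    [IsClosedImmersion ι.left] : IsClosedImmersion (toSegre N ι).left := by
  have h1 : IsClosedImmersion (ι ⊗ₘ 𝟙 (dualProjectiveSpace N ℂ)).left :=
    isClosedImmersion_tensorHom_left ι (𝟙 _)
  have h2 : (ι ▷ dualProjectiveSpace N ℂ) = (ι ⊗ₘ 𝟙 (dualProjectiveSpace N ℂ)) :=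
    (MonoidalCategory.tensorHom_id ι _).symm
  change IsClosedImmersion ((ι ▷ dualProjectiveSpace N ℂ) ≫ segreEmbedding N N ℂ).left
  rw [Over.comp_left, h2]
  infer_instance


/-- `ℓ_a` is homogeneous of degree `1`. [folklore] -/
theorem isHomogeneous_linForm {N : ℕ} (a : Fin (N + 1) → ℂ) : (∑ i, MvPolynomial.C (a i) * MvPolynomial.X i).IsHomogeneous 1 :=
  MvPolynomial.IsHomogeneous.sum _ _ _ fun i _ ↦
    (MvPolynomial.isHomogeneous_C _ (a i)).mul (MvPolynomial.isHomogeneous_X _ i)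

/-- A smooth projective variety of positive dimension does not embed in `ℙ⁰`: `N ≥ 1` for every
projective embedding `e : X ↪ ℙᴺ` (else `X(ℂ) ↪ ℙ⁰(ℂ)` is a point, while `H^{2 dim X}(X(ℂ); ℂ) ≠ 0`).
[cite: HatcherAT2002, §3.1 p. 199] [cite: Hartshorne1977, II Ex. 2.14] -/
theorem one_le_n_projectiveEmbedding {m : ℕ} {X : SchemeOver ℂ} (hX : IsSmoothProjective (m + 1) X)
    (e : ProjectiveEmbedding X) : 1 ≤ e.n := by
  haveI := e.isClosedImmersion
  by_contra hN0
  have hN0 : e.n = 0 := by omega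
  have hsub : Subsingleton (ComplexPoints (projectiveSpace e.n ℂ)) := by
    refine ⟨fun Q Q' ↦ ?_⟩
    obtain ⟨z, hz, rfl⟩ := ProjectiveSpace.exists_eq_pointOfVec Q
    obtain ⟨z', hz', rfl⟩ := ProjectiveSpace.exists_eq_pointOfVec Q'
    have h0 : ∀ i : Fin (e.n + 1), i = 0 := fun i ↦ Fin.ext (by have := i.2; simp only [Fin.val_zero]; omega)
    have hz0 : z 0 ≠ 0 := fun h ↦ hz (funext fun i ↦ by rw [h0 i, h]; rfl)
    refine (ProjectiveSpace.pointOfVec_eq_pointOfVec_iff z z' hz hz').2 ⟨z' 0 / z 0, ?_, funext fun i ↦ ?_⟩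
    · intro h
      rcases div_eq_zero_iff.1 h with h' | h'
      · exact hz' (funext fun i ↦ by rw [h0 i, h']; rfl)
      · exact hz0 h'
    · rw [h0 i, Pi.smul_apply, smul_eq_mul, div_mul_cancel₀ _ hz0]
  haveI : Subsingleton (ComplexPoints X) :=
    (AlgPoints.isEmbedding_map_of_isClosedImmersion (L := ℂ) e.ι).injective.subsingleton
  obtain ⟨ρ, -, hρ⟩ := exists_isRationalClass_ne_zero_of_degree_eq_two_mul hX
  haveI := ModuleCat.subsingleton_of_isZero
    (singularCochainComplex.isZero_singularCohomology_of_subsingleton' (R := ℂ) (M := ℂ)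
      (X := ComplexPoints X) (n := 2 * (m + 1)) (by omega))
  exact hρ (Subsingleton.elim _ _)

/-! ### Small topological inputs -/

/-- A class of positive degree pulled back from the parameter space `T` dies on every slice
`X × {t}`: `s_t^* pr₂^* b = (X → Spec ℂ → T)^* b` factors through `H^j(pt) = 0` (the tree's
`HodgeBeyondAnchors.complexBetti_map_toSpecOver_comp`). [cite: HatcherAT2002, §3.1 p. 199] -/
theorem map_sliceAt_map_snd_eq_zero (X : SchemeOver ℂ) {T : SchemeOver ℂ} (t : ComplexPoints T) {j : ℕ}
    (hj : j ≠ 0) (b : complexBetti T j) :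
    complexBetti.map (sliceAt X t) j (complexBetti.map (snd X T) j b) = 0 := by
  rw [← CategoryTheory.comp_apply, ← complexBetti.map_comp, sliceAt_snd]
  exact HodgeBeyondAnchors.complexBetti_map_toSpecOver_comp t hj b

/-- `H¹(ℙᴺ(ℂ); ℂ) = 0` (`H₁(ℂℙᴺ; ℂ) = 0`, Hatcher Thm. 2.35 (iii), and `H¹ ↪ Hom(H₁, ℂ)` over a field).
[cite: HatcherAT2002, §2.2 Thm. 2.35 (iii) and §3.1 Thm. 3.2] -/
theorem subsingleton_complexBetti_projectiveSpace_one (N : ℕ) :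
    Subsingleton (complexBetti (projectiveSpace N ℂ) 1) := by
  have hz := (Literature.Topology.FourManifolds.singularHomology_complexProjectiveSpace_of_module ℂ ℂ N 1).2
    (fun h ↦ Nat.not_even_one h.1)
  haveI := ModuleCat.subsingleton_of_isZero hz
  haveI : Subsingleton (singularCohomology ℂ ℂ (Literature.Topology.FourManifolds.ComplexProjectiveSpace N) 1) :=
    (kroneckerPairing_injective_of_field ℂ (Literature.Topology.FourManifolds.ComplexProjectiveSpace N) 1).subsingleton
  exact (singularCohomology.mapIso ℂ ℂ
    (complexPointsProjectiveSpaceHomeomorph N) 1).toLinearEquiv.toEquiv.symm.subsingleton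

/-- **Ambient classes times algebraic classes are algebraic**: for `Y` smooth projective,
`ι : Y → ℙᴺ`, `θ ∈ H^{2l}(ℙᴺ(ℂ); ℂ)` and `w ∈ Nᵏ H^{2k}(Y(ℂ); ℂ)`, the class `ι^* θ ∪ w` lies in
`N^{l+k}`: `ι^* θ` dies off the preimage of a linear subspace in general position with respect to a
support of `w` (the tree's `map_projectiveSpace_mem_iSup_ker_restrictCompl`, Eisenbud–Harris §1.3), and
cup products multiply supports (`cupProduct_mem_supportedClasses_of_inter`).
[cite: EisenbudHarris2016, §1.3] [cite: VoisinHodgeII2003, §9.2.4 Prop. 9.20] -/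
theorem cupProduct_map_projectiveSpace_mem_algebraicClasses {n N l k s : ℕ} {Y : SchemeOver ℂ}
    (hY : IsSmoothProjective n Y) (ι : Y ⟶ projectiveSpace N ℂ) (θ : complexBetti (projectiveSpace N ℂ) (2 * l))
    {w : complexBetti Y (2 * k)} (hw : w ∈ algebraicClasses Y k) (hs : l + k = s) (h2 : 2 * l + 2 * k = 2 * s) :
    cupProduct h2 (complexBetti.map ι (2 * l) θ) w ∈ algebraicClasses Y s := by
  subst hs
  obtain ⟨W, hWc, hWk, hw0⟩ := exists_support_of_mem_supportedClasses hw
  have hmem := map_projectiveSpace_mem_iSup_ker_restrictCompl hY ι hWc hWk (l := l) θ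
  suffices h : (⨆ (T : Set Y.left) (_ : IsClosed T) (_ : ∀ t ∈ T ∩ W, ((l + k : ℕ) : ℕ∞) ≤ Order.coheight t),
      LinearMap.ker (complexBetti.restrictCompl Y T (2 * l)).hom) ≤
      (algebraicClasses Y (l + k)).comap ((cupProduct h2).flip w) by
    have h' := h hmem
    rwa [Submodule.mem_comap, LinearMap.flip_apply] at h'
  refine iSup_le fun T ↦ iSup_le fun hT ↦ iSup_le fun hcodim ↦ fun x hx ↦ ?_
  rw [Submodule.mem_comap, LinearMap.flip_apply]
  exact cupProduct_mem_supportedClasses_of_inter hT hWc hcodim _ (LinearMap.mem_ker.1 hx) hw0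


end Summit.HodgeConjecture.HodgeConjecture.Theorems

end
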